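import Summits.Ventures.HodgeRepro2.T5SU11KernelCompositionODE

/-!
# The jump of the kernel's derivative across the diagonal: `∂_t K_λ(s⁺, s) − ∂_t K_λ(s⁻, s) = 1/sinh 2s`

On `(0, s]` the kernel is `K_λ(·, s) = −χ_λ(s) φ_λ`, on `[s, ∞)` it is `−φ_λ(a_s) χ_λ`; both formulas agree at `t = s`, so the
kernel is continuous across the diagonal, while its one-sided derivatives there are `−χ_λ(s) φ_λ′(s)` and `−φ_λ(a_s) χ_λ′(s)`.
Their difference is minus the Wronskian: by row 447's `sinh 2s (φ_λ χ_λ′ − φ_λ′ χ_λ) = −1`,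

  **`∂_t K_λ(s⁺, s) − ∂_t K_λ(s⁻, s) = 1/sinh 2s`** (`kernel_deriv_jump`)

— the classical jump relation of a Green's function for the operator `(sinh 2t · u′)′`, whose leading coefficient is `sinh 2t`.

* `hasDerivWithinAt_kernel_Iic`, `hasDerivWithinAt_kernel_Ici` — the one-sided derivatives at the diagonal;
* `kernel_deriv_jump` — **the jump `1/sinh 2s`**;
* `kernel_deriv_jump'` — the same in the form `sinh 2s · (∂_t K(s⁺, s) − ∂_t K(s⁻, s)) = 1`.

Nothing is claimed about (N).

Blind lane: Mathlib + the HodgeRepro2 prefix only; no sorry; axioms ⊆ {propext, Classical.choice,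
Quot.sound}.
-/

namespace Summit.Ventures.HodgeRepro2.T5SU11KernelDiagonalJump

open Filter Topology MeasureTheory
open Set (Ioi Iic Ici)
open T5SU11Cartan T5SU11SphericalFunction T5SU11SphericalDecay T5SU11SphericalSolutionSpaceAll T5SU11RadialGreenKernel

section measure

variable [MeasurableSpace Circle] [BorelSpace Circle]

variable {lam : ℝ} (hlam : 1 < lam) {s : ℝ} (hs : 0 < s)

include hs in
/-- **The left derivative of `K_λ(·, s)` at the diagonal** is `−χ_λ(s) φ_λ′(s)` (`K_λ(·, s) = −χ_λ(s) φ_λ` on `(−∞, s]`). -/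
theorem hasDerivWithinAt_kernel_Iic :
    HasDerivWithinAt (fun r => sphGreenKernel lam r s) (-(sphDecay lam s * deriv (fun t => sph lam (hyp t)) s))
      (Iic s) s := by
  have h := (((hφ_sph lam) s hs).const_mul (sphDecay lam s)).neg.hasDerivWithinAt (s := Iic s)
  refine h.congr ?_ ?_
  · intro r hr
    unfold sphGreenKernel
    rw [greenKernel_of_ge _ _ hr]
    simp only [Pi.neg_apply]
    ring
  · unfold sphGreenKernel
    rw [greenKernel_of_ge _ _ le_rfl]
    simp only [Pi.neg_apply]
    ring

include hlam hs in
/-- **The right derivative of `K_λ(·, s)` at the diagonal** is `−φ_λ(a_s) χ_λ′(s)` (`K_λ(·, s) = −φ_λ(a_s) χ_λ` on `[s, ∞)`). -/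
theorem hasDerivWithinAt_kernel_Ici :
    HasDerivWithinAt (fun r => sphGreenKernel lam r s) (-(sph lam (hyp s) * sphDecay' lam s)) (Ici s) s := by
  have h := ((hasDerivAt_sphDecay hlam hs).const_mul (sph lam (hyp s))).neg.hasDerivWithinAt (s := Ici s)
  refine h.congr ?_ ?_
  · intro r hr
    unfold sphGreenKernel
    rw [greenKernel_of_le _ _ hr]
    simp only [Pi.neg_apply]
  · unfold sphGreenKernel
    rw [greenKernel_of_le _ _ le_rfl]
    simp only [Pi.neg_apply]

include hlam hs in
/-- **THE JUMP RELATION**: `∂_t K_λ(s⁺, s) − ∂_t K_λ(s⁻, s) = 1/sinh 2s` — the right derivative minus the left derivative of the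
kernel at the diagonal is the reciprocal of the leading coefficient `sinh 2s` of the radial operator. -/
theorem kernel_deriv_jump :
    -(sph lam (hyp s) * sphDecay' lam s) - (-(sphDecay lam s * deriv (fun t => sph lam (hyp t)) s))
      = 1 / Real.sinh (2 * s) := by
  have hW := wronskian_sphDecay hlam hs
  have hsinh : 0 < Real.sinh (2 * s) := T5SU11ReductionOfOrder.sinh_two_mul_pos hs
  rw [eq_div_iff hsinh.ne']
  linear_combination -hW

include hlam hs in
/-- The jump relation in the form `sinh 2s · (∂_t K_λ(s⁺, s) − ∂_t K_λ(s⁻, s)) = 1`. -/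
theorem kernel_deriv_jump' :
    Real.sinh (2 * s) * (-(sph lam (hyp s) * sphDecay' lam s) - (-(sphDecay lam s * deriv (fun t => sph lam (hyp t)) s)))
      = 1 := by
  have hW := wronskian_sphDecay hlam hs
  linear_combination -hW

end measure

end Summit.Ventures.HodgeRepro2.T5SU11KernelDiagonalJump
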